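import Summits.KontsevichZagierPeriods.KontsevichZagierPeriods.Theses.LiftingCriteria
import Summits.KontsevichZagierPeriods.KontsevichZagierPeriods.Theorems.SymplecticScissorsRealOnePeriodRelationsStubPuiseuxGerm
import Summits.KontsevichZagierPeriods.KontsevichZagierPeriods.Theorems.SymplecticScissorsRealOnePeriodRelationsStubArcSymbolsFlatten
import Summits.KontsevichZagierPeriods.KontsevichZagierPeriods.Theorems.SymplecticScissorsRealOnePeriodRelationsStubArcSymbolsCut
import Literature.NumberTheory.Transcendental.KZSemiCanonicalReductionProofs

/-!
# `CubeNashNormalForm` (stmt-KontsevichZagierPeriods-3574), `k ≤ 1`: the ramified chart of a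
# half-cell is a cube–Nash representation

Support file for the item `CubeNashNormalForm` of route `LiftingCriteria`. Let `N ≤ FormalRep`
contain the relations and the cube–Nash generators. For a one-dimensional representation `r` on
`(a, b)`, a cell `(u, v) ⊆ (a, b)` on which the integrand `f` is real analytic, and a half-cell
`x = p + σ L t`, `t ∈ (0, 1]` (`p`, `L > 0` algebraic, `σ = ±1`) with open part `(lo, hi)`, the cut
`ArcSymbols.cut r lo hi` lies in `N` (`of_cut_mem`): by the real Puiseux germ of `y ↦ f (p + σLy)`
(`RealOnePeriodRelations.PuiseuxGerm.puiseuxGerm`) and the substitution `x = p + σ L w^{2q}`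
(`ArcSymbols.exists_pullback`, rule 2) the integrand becomes `G(w) = 2qL w^{2q−1} f(p + σLw^{2q})`,
which near `0⁺` is the odd-times-even analytic germ `J(w) = 2qL w^{2k+1} h(w²)` (absolute
integrability forces `2q − 1 + 2m = 2k + 1`, `ArcSymbols.order_nonneg_of_integrable`); gluing `J`
(left of a small `ρ₀`) to `G` gives an integrand analytic and `ℚ`-semialgebraic on a rational open
interval around `[0, 1]` (on the negative side it is `w ↦ −G(−w)`), i.e. a cube–Nash generator after
closing the two null end points. [Kontsevich–Zagier 2001, §1.2; Bochnak–Coste–Roy 1998, §8.1]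
-/


noncomputable section

open Set MeasureTheory Filter Topology
open Literature.ModelTheory.ExponentialFields (IsSemialgebraic)
open Literature.NumberTheory.Transcendental
open Literature.NumberTheory.Transcendental.KZ
open Summit.KontsevichZagierPeriods.SymplecticScissors.RealOnePeriodRelations
open Summit.KontsevichZagierPeriods.SymplecticScissors.RealOnePeriodRelations.ArcSymbols

namespace Summit.KontsevichZagierPeriods.LiftingCriteria.CubeNashNormalFormHalfCell

/-- **The ramified chart of a half-cell is a cube–Nash representation.** See the module
docstring. [cite: KontsevichZagier2001, §1.2 rules (1)-(2); BochnakCosteRoy1998, §8.1] -/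
theorem of_cut_mem (N : AddSubgroup FormalRep) (hrel : relations ≤ N)
    (hgen : ∀ {m : ℕ} (t : IntegralRep m) (g : (Fin m → ℝ) → ℝ) (U : Set (Fin m → ℝ)),
      IsOpen U → Set.pi Set.univ (fun _ : Fin m => Set.Icc (0:ℝ) 1) ⊆ U →
      IsSemialgebraicFunOn ℚ U g → AnalyticOnNhd ℝ g U →
      t.domain = Set.pi Set.univ (fun _ : Fin m => Set.Icc (0:ℝ) 1) →
      (∀ z ∈ Set.pi Set.univ (fun _ : Fin m => Set.Icc (0:ℝ) 1), t.integrand z = g z) → of t ∈ N)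
    (r : IntegralRep 1) {a b : ℝ} (hdom : r.domain = {z : Fin 1 → ℝ | z 0 ∈ Ioo a b})
    {u v : ℝ} (huv : Ioo u v ⊆ Ioo a b)
    (han : ∀ x ∈ Ioo u v, AnalyticAt ℝ (fun t => r.integrand fun _ => t) x)
    (p L σ : ℝ) (hp : IsAlgebraic ℚ p) (hL : 0 < L) (hLa : IsAlgebraic ℚ L) (hσ : σ = 1 ∨ σ = -1)
    (hseg : ∀ t ∈ Ioc (0 : ℝ) 1, p + σ * L * t ∈ Ioo u v)
    (lo hi : ℝ) (hlo : IsAlgebraic ℚ lo) (hhi : IsAlgebraic ℚ hi) (hlohi : Ioo lo hi ⊆ Ioo u v)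
    (himg : (fun y => p + σ * L * y) '' Ioo (0 : ℝ) 1 = Ioo lo hi) :
    of (cut r lo hi) ∈ N := by
  classical
  set f : ℝ → ℝ := fun t => r.integrand fun _ => t with hf
  have hfz : ∀ z : Fin 1 → ℝ, r.integrand z = f (z 0) := fun z => by
    rw [hf]
    exact congrArg r.integrand (funext fun i => by rw [Fin.fin_one_eq_zero i])
  have hσa : IsAlgebraic ℚ σ := by
    rcases hσ with h' | h' <;> rw [h']
    · exact isAlgebraic_one
    · exact isAlgebraic_one.neg
  have hsa_f : IsSemialgebraicFunOn ℚ {z : Fin 1 → ℝ | z 0 ∈ Ioo a b} (fun z => f (z 0)) := by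
    have h1 := r.isSemialgebraicFunOn_integrand
    rw [hdom] at h1
    exact h1.congr fun z _ => hfz z
  have hU : IsSemialgebraic ℚ {z : Fin 1 → ℝ | z 0 ∈ Ioo (0 : ℝ) 1} := isSemialgebraic_unitIoo
  -- ### the Puiseux germ of `y ↦ f (p + σ L y)` at `0⁺`
  have hsa_fL : IsSemialgebraicFunOn ℚ {z : Fin 1 → ℝ | z 0 ∈ Ioo (0 : ℝ) (0 + 1)}
      (fun z => f (p + σ * L * z 0)) := by
    rw [zero_add]
    have hX : IsSemialgebraicFunOn ℚ {z : Fin 1 → ℝ | z 0 ∈ Ioo (0 : ℝ) 1} (fun z => z 0) :=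
      (isSemialgebraicFunOn_aeval hU (MvPolynomial.X 0)).congr fun z _ => by simp
    have haff : IsSemialgebraicFunOn ℚ {z : Fin 1 → ℝ | z 0 ∈ Ioo (0 : ℝ) 1}
        (fun z => p + σ * L * z 0) :=
      (isSemialgebraicFunOn_const_of_isAlgebraic hU hp).fun_add
        (((isSemialgebraicFunOn_const_of_isAlgebraic hU hσa).fun_mul
          (isSemialgebraicFunOn_const_of_isAlgebraic hU hLa)).fun_mul hX)
    have hmap : IsSemialgebraicMapOn ℚ {z : Fin 1 → ℝ | z 0 ∈ Ioo (0 : ℝ) 1}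
        (fun z : Fin 1 → ℝ => fun _ : Fin 1 => p + σ * L * z 0) :=
      IsSemialgebraicMapOn.of_forall hU fun _ => haff
    have hmaps : MapsTo (fun z : Fin 1 → ℝ => fun _ : Fin 1 => p + σ * L * z 0)
        {z : Fin 1 → ℝ | z 0 ∈ Ioo (0 : ℝ) 1} {z : Fin 1 → ℝ | z 0 ∈ Ioo a b} :=
      fun z hz => huv (hseg (z 0) ⟨hz.1, hz.2.le⟩)
    exact (IsSemialgebraicFunOn.comp_isSemialgebraicMapOn_holds hsa_f hmap hmaps).congr
      fun z _ => rfl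
  obtain ⟨q, m, h, hq, hh, -, hh0, hgerm⟩ :=
    PuiseuxGerm.puiseuxGerm (fun y => f (p + σ * L * y)) 0 1 isAlgebraic_zero one_pos hsa_fL
  obtain ⟨ε, hε, hεsub⟩ : ∃ ε > 0, ∀ s ∈ Ioo (0 : ℝ) ε, f (p + σ * L * s ^ q) = s ^ m * h s := by
    obtain ⟨ε, hε, h'⟩ := mem_nhdsGT_iff_exists_Ioo_subset.1 hgerm
    exact ⟨ε, hε, fun s hs => by simpa using h' hs⟩
  obtain ⟨ε₂, hε₂, hh'⟩ : ∃ ε₂ > 0, ∀ z : ℝ, |z| < ε₂ → AnalyticAt ℝ h z := by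
    obtain ⟨ε₂, hε₂, h'⟩ := Metric.eventually_nhds_iff_ball.mp hh.eventually_analyticAt
    exact ⟨ε₂, hε₂, fun z hz => h' z (by simpa using hz)⟩
  -- ### the substitution `x = p + σ L w^Q`, `Q = 2q`, and the pulled-back representation
  set Q : ℕ := 2 * q with hQ
  have hQpos : 0 < Q := by omega
  obtain ⟨hφsa, hφder, -, hφabs, hφinj, hφimg⟩ := powSubst_props p L σ Q hQpos hL hσ hp hLa
  have hcutdom : (cut r lo hi).domain =
      {z : Fin 1 → ℝ | z 0 ∈ (fun y => p + σ * L * y) '' Ioo (0 : ℝ) 1} := by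
    rw [cut_domain r hlo hhi, hdom, himg]
    ext z
    simp only [mem_inter_iff, mem_setOf_eq]
    exact ⟨fun hz => hz.2, fun hz => ⟨huv (hlohi hz), hz⟩⟩
  obtain ⟨R, hRdom, hRint, hRcov⟩ := exists_pullback (cut r lo hi) (fun s => p + σ * L * s ^ Q)
    (fun s => σ * L * (Q * s ^ (Q - 1))) hφsa (fun s _ => hφder s) hφinj (by rw [hcutdom, hφimg])
  set G : ℝ → ℝ := fun w => f (p + σ * L * w ^ Q) * (Q * L * w ^ (Q - 1)) with hG
  have hRG : ∀ z ∈ R.domain, R.integrand z = G (z 0) := by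
    intro z hz
    rw [hRdom] at hz
    rw [hRint z, cut_integrand r hlo hhi, hfz, hφabs (z 0) hz]
  have hGint : IntegrableOn G (Ioo (0 : ℝ) 1) := by
    have h1 : IntegrableOn (fun z : Fin 1 → ℝ => G (z 0)) {z : Fin 1 → ℝ | z 0 ∈ Ioo (0 : ℝ) 1} := by
      rw [← hRdom]
      exact R.integrableOn.congr_fun (fun z hz => hRG z hz) (hRdom ▸ (measurableSet_Ioo.preimage
        (measurable_pi_apply 0)))
    exact (integrableOn_comp_apply_iff G _).1 h1
  obtain ⟨θ, hθ, hθcell⟩ : ∃ θ > 0, ∀ w ∈ Ioo (1 : ℝ) (1 + θ), p + σ * L * w ^ Q ∈ Ioo u v := by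
    have hc : ContinuousAt (fun w : ℝ => p + σ * L * w ^ Q) 1 := by fun_prop
    have h1 : p + σ * L * (1 : ℝ) ^ Q ∈ Ioo u v := by rw [one_pow]; exact hseg 1 ⟨one_pos, le_rfl⟩
    have hev := hc.preimage_mem_nhds (isOpen_Ioo.mem_nhds h1)
    obtain ⟨θ, hθ, hball⟩ := Metric.mem_nhds_iff.mp hev
    exact ⟨θ, hθ, fun w hw => hball (by
      rw [Metric.mem_ball, Real.dist_eq, abs_sub_lt_iff]; exact ⟨by linarith [hw.2], by linarith [hw.1]⟩)⟩
  obtain ⟨w₁, hw₁1, hw₁θ⟩ := exists_rat_btwn (show (1 : ℝ) < 1 + θ by linarith)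
  have hφcell : ∀ w ∈ Ioo (0 : ℝ) w₁, p + σ * L * w ^ Q ∈ Ioo u v := by
    intro w hw
    rcases le_or_gt w 1 with hw1 | hw1
    · exact hseg (w ^ Q) ⟨pow_pos hw.1 Q, pow_le_one₀ hw.1.le hw1⟩
    · exact hθcell w ⟨hw1, hw.2.trans hw₁θ⟩
  -- ### the odd-times-even germ `J` of `G` at `0⁺`
  set ε' : ℝ := min ε 1 with hε'
  have hε'pos : 0 < ε' := lt_min hε one_pos
  have hsq : ∀ w ∈ Ioo (0 : ℝ) ε', w ^ 2 ∈ Ioo (0 : ℝ) ε := fun w hw => by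
    have hw1 : w < 1 := hw.2.trans_le (min_le_right _ _)
    refine ⟨pow_pos hw.1 2, ?_⟩
    calc w ^ 2 ≤ w ^ 1 := pow_le_pow_of_le_one hw.1.le hw1.le (by norm_num)
      _ = w := pow_one w
      _ < ε := hw.2.trans_le (min_le_left _ _)
  have hGgerm : ∀ w ∈ Ioo (0 : ℝ) ε',
      G w = (Q : ℝ) * L * w ^ (Q - 1) * ((w ^ 2) ^ m * h (w ^ 2)) := by
    intro w hw
    have h1 := hεsub (w ^ 2) (hsq w hw)
    have h2 : w ^ Q = (w ^ 2) ^ q := by rw [hQ, pow_mul]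
    rw [hG]
    simp only
    rw [h2, h1]
    ring
  obtain ⟨k, hGJ⟩ : ∃ k : ℕ, ∀ w ∈ Ioo (0 : ℝ) ε',
      G w = (Q : ℝ) * L * w ^ (2 * k + 1) * h (w ^ 2) := by
    rcases hh0 with hh0 | hh0
    · -- `h 0 ≠ 0`: integrability forces `2q - 1 + 2m ≥ 0`
      have hK : (Q : ℝ) * L ≠ 0 := mul_ne_zero (Nat.cast_ne_zero.mpr hQpos.ne') hL.ne'
      have hφc : ContinuousAt (fun s : ℝ => h (s ^ 2)) 0 :=
        hh.continuousAt.comp_of_eq (continuous_pow 2).continuousAt (by simp)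
      have hM := order_nonneg_of_integrable (g := G) (φ := fun s => h (s ^ 2)) (M := ((Q - 1 : ℕ) : ℤ) + 2 * m)
        hK hε'pos hφc (by simpa using hh0) (fun s hs => ?_) hGint
      · have hmq : 0 ≤ m + q - 1 := by
          have : ((Q - 1 : ℕ) : ℤ) = 2 * q - 1 := by rw [hQ]; omega
          rw [this] at hM
          omega
        refine ⟨(m + q - 1).toNat, fun w hw => ?_⟩
        have hw0 : (0 : ℝ) < w := hw.1
        rw [hGgerm w hw]
        have hk : (((m + q - 1).toNat : ℕ) : ℤ) = m + q - 1 := Int.toNat_of_nonneg hmq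
        have hexp : (w ^ 2) ^ m * w ^ (Q - 1) = w ^ (2 * (m + q - 1).toNat + 1) := by
          rw [← zpow_natCast w (2 * (m + q - 1).toNat + 1), ← zpow_natCast w (Q - 1),
            ← zpow_natCast w 2, ← zpow_mul, ← zpow_add₀ hw0.ne']
          congr 1
          push_cast
          rw [hk, Nat.cast_sub (by omega : 1 ≤ Q), hQ]
          push_cast
          ring
        calc (Q : ℝ) * L * w ^ (Q - 1) * ((w ^ 2) ^ m * h (w ^ 2))
            = (Q : ℝ) * L * ((w ^ 2) ^ m * w ^ (Q - 1)) * h (w ^ 2) := by ring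
          _ = (Q : ℝ) * L * w ^ (2 * (m + q - 1).toNat + 1) * h (w ^ 2) := by rw [hexp]
      · -- the shape required by `order_nonneg_of_integrable`
        have hs0 : (0 : ℝ) < s := hs.1
        rw [hGgerm s hs]
        have : (s ^ 2) ^ m * s ^ (Q - 1) = s ^ (((Q - 1 : ℕ) : ℤ) + 2 * m) := by
          rw [← zpow_natCast s (Q - 1), ← zpow_natCast s 2, ← zpow_mul, ← zpow_add₀ hs0.ne']
          congr 1
          push_cast
          ring
        calc (Q : ℝ) * L * s ^ (Q - 1) * ((s ^ 2) ^ m * h (s ^ 2))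
            = (Q : ℝ) * L * ((s ^ 2) ^ m * s ^ (Q - 1)) * h (s ^ 2) := by ring
          _ = (Q : ℝ) * L * s ^ (((Q - 1 : ℕ) : ℤ) + 2 * m) * h (s ^ 2) := by rw [this]
    · -- `h ≡ 0`: the germ vanishes
      refine ⟨0, fun w hw => ?_⟩
      rw [hGgerm w hw, hh0]
      ring
  set J : ℝ → ℝ := fun w => (Q : ℝ) * L * w ^ (2 * k + 1) * h (w ^ 2) with hJ
  have hJan : ∀ w : ℝ, |w| < min ε₂ 1 → AnalyticAt ℝ J w := by
    intro w hw
    have hw2 : |w ^ 2| < ε₂ := by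
      rw [abs_pow]
      calc |w| ^ 2 ≤ |w| ^ 1 := pow_le_pow_of_le_one (abs_nonneg w)
            (hw.le.trans (min_le_right _ _)) (by norm_num)
        _ = |w| := pow_one _
        _ < ε₂ := hw.trans_le (min_le_left _ _)
    have hpow : ∀ n : ℕ, AnalyticAt ℝ (fun x : ℝ => x ^ n) w := fun n =>
      (analyticAt_id (𝕜 := ℝ) (z := w)).pow n
    have hcomp : AnalyticAt ℝ (fun x : ℝ => h (x ^ 2)) w :=
      (hh' (w ^ 2) hw2).comp (f := fun x : ℝ => x ^ 2) (hpow 2)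
    exact (analyticAt_const.mul (hpow _)).mul hcomp
  have hJodd : ∀ w : ℝ, J (-w) = -J w := fun w => by
    have h1 : (-w) ^ (2 * k + 1) = -(w ^ (2 * k + 1)) := Odd.neg_pow ⟨k, rfl⟩ _
    have h2 : (-w) ^ 2 = w ^ 2 := neg_sq w
    simp only [hJ, h1, h2]
    ring
  -- ### the glued function `Gt`
  set ρ₀ : ℝ := min (1 / 2) (min (ε / 2) (ε₂ / 2)) with hρ₀
  have hρ₀pos : 0 < ρ₀ := lt_min (by norm_num) (lt_min (by linarith) (by linarith))
  have hρ₀half : ρ₀ ≤ 1 / 2 := min_le_left _ _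
  have hρ₀ε₂ : ρ₀ ≤ ε₂ / 2 := (min_le_right _ _).trans (min_le_right _ _)
  have hρ₀ε : ρ₀ ≤ ε / 2 := (min_le_right _ _).trans (min_le_left _ _)
  have hρ₀ε' : ρ₀ ≤ ε' := le_min (by linarith) (by linarith)
  obtain ⟨ρ₁, hρ₁0, hρ₁⟩ := exists_rat_btwn hρ₀pos
  set Gt : ℝ → ℝ := fun w => if w < ρ₀ then J w else G w with hGt
  have hGtJ : ∀ w : ℝ, w < ρ₀ → Gt w = J w := fun w hw => by rw [hGt]; simp only [if_pos hw]
  have hGtG : ∀ w : ℝ, 0 < w → Gt w = G w := by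
    intro w hw
    by_cases hwρ : w < ρ₀
    · rw [hGtJ w hwρ]
      exact (hGJ w ⟨hw, hwρ.trans_le hρ₀ε'⟩).symm
    · rw [hGt]; simp only [if_neg hwρ]
  -- ### analyticity on `(-ρ₀, w₁)`
  have hGan : ∀ w ∈ Ioo (0 : ℝ) w₁, AnalyticAt ℝ G w := by
    intro w hw
    have h1 : AnalyticAt ℝ f (p + σ * L * w ^ Q) := han _ (hφcell w hw)
    have h2 : AnalyticAt ℝ (fun x : ℝ => p + σ * L * x ^ Q) w :=
      analyticAt_const.add (analyticAt_const.mul ((analyticAt_id (𝕜 := ℝ) (z := w)).pow Q))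
    have h3 : AnalyticAt ℝ (fun x : ℝ => (Q : ℝ) * L * x ^ (Q - 1)) w :=
      analyticAt_const.mul ((analyticAt_id (𝕜 := ℝ) (z := w)).pow (Q - 1))
    exact (AnalyticAt.comp (g := f) (f := fun x : ℝ => p + σ * L * x ^ Q) h1 h2).mul h3
  have hGtan : ∀ w ∈ Ioo (-ρ₀) (w₁ : ℝ), AnalyticAt ℝ Gt w := by
    intro w hw
    by_cases hwρ : w < ρ₀
    · have hJw : AnalyticAt ℝ J w := hJan w (by
        refine lt_min ?_ ?_
        · rw [abs_lt]
          exact ⟨by linarith [hw.1], by linarith⟩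
        · rw [abs_lt]
          exact ⟨by linarith [hw.1], by linarith⟩)
      refine hJw.congr ?_
      filter_upwards [Iio_mem_nhds hwρ] with x hx using (hGtJ x hx).symm
    · push Not at hwρ
      have hw0 : 0 < w := hρ₀pos.trans_le hwρ
      refine (hGan w ⟨hw0, hw.2⟩).congr ?_
      filter_upwards [Ioi_mem_nhds hw0] with x hx using (hGtG x hx).symm
  -- ### semialgebraicity on `U = (-ρ₁, w₁)`
  set U : Set (Fin 1 → ℝ) := {t | t 0 ∈ Ioo (-(ρ₁ : ℝ)) w₁} with hUdef
  set Sp : Set (Fin 1 → ℝ) := {t | t 0 ∈ Ioo (0 : ℝ) w₁} with hSpdef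
  set Sm : Set (Fin 1 → ℝ) := {t | t 0 ∈ Ioo (-(ρ₁ : ℝ)) 0} with hSmdef
  set S0 : Set (Fin 1 → ℝ) := {t | t 0 = 0} with hS0def
  have hSp : IsSemialgebraic ℚ Sp := by
    rw [hSpdef]
    simpa using isSemialgebraic_IooDom isAlgebraic_zero (isAlgebraic_algebraMap w₁)
  have hSm : IsSemialgebraic ℚ Sm := by
    rw [hSmdef]
    simpa using isSemialgebraic_IooDom (isAlgebraic_algebraMap (-ρ₁)) isAlgebraic_zero
  have hS0 : IsSemialgebraic ℚ S0 := isSemialgebraic_setOf_apply_eq_of_isAlgebraic isAlgebraic_zero 0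
  have hGsa : IsSemialgebraicFunOn ℚ Sp (fun t => G (t 0)) := by
    have hX : IsSemialgebraicFunOn ℚ Sp (fun z => z 0) :=
      (isSemialgebraicFunOn_aeval hSp (MvPolynomial.X 0)).congr fun z _ => by simp
    have hφ' : IsSemialgebraicFunOn ℚ Sp (fun z => p + σ * L * (z 0) ^ Q) :=
      (isSemialgebraicFunOn_const_of_isAlgebraic hSp hp).fun_add
        (((isSemialgebraicFunOn_const_of_isAlgebraic hSp hσa).fun_mul
          (isSemialgebraicFunOn_const_of_isAlgebraic hSp hLa)).fun_mul (hX.fun_pow Q))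
    have hmap : IsSemialgebraicMapOn ℚ Sp (fun z : Fin 1 → ℝ => fun _ : Fin 1 => p + σ * L * (z 0) ^ Q) :=
      IsSemialgebraicMapOn.of_forall hSp fun _ => hφ'
    have hmaps : MapsTo (fun z : Fin 1 → ℝ => fun _ : Fin 1 => p + σ * L * (z 0) ^ Q) Sp
        {z : Fin 1 → ℝ | z 0 ∈ Ioo a b} := fun z hz => huv (hφcell (z 0) hz)
    have hcomp := IsSemialgebraicFunOn.comp_isSemialgebraicMapOn_holds hsa_f hmap hmaps
    have hfac : IsSemialgebraicFunOn ℚ Sp (fun z => (Q : ℝ) * L * (z 0) ^ (Q - 1)) :=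
      ((isSemialgebraicFunOn_natCast hSp Q).fun_mul (isSemialgebraicFunOn_const_of_isAlgebraic hSp hLa)).fun_mul
        (hX.fun_pow (Q - 1))
    exact (hcomp.fun_mul hfac).congr fun z _ => by simp [hG, Function.comp]
  have h1 : IsSemialgebraicFunOn ℚ Sp (fun t => Gt (t 0)) := hGsa.congr fun z hz => (hGtG (z 0) hz.1).symm
  have hGtm : ∀ t ∈ Sm, Gt (t 0) = -G (-(t 0)) := by
    intro t ht
    have ht' : t 0 ∈ Ioo (-(ρ₁ : ℝ)) 0 := ht
    have hneg : 0 < -(t 0) := by linarith [ht'.2]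
    have hlt : -(t 0) < ρ₀ := by linarith [ht'.1]
    have hodd : J (t 0) = -J (-(t 0)) := by simpa only [neg_neg] using hJodd (-(t 0))
    rw [hGtJ (t 0) (ht'.2.trans hρ₀pos), hodd, hGJ (-(t 0)) ⟨hneg, hlt.trans_le hρ₀ε'⟩]
  have h2 : IsSemialgebraicFunOn ℚ Sm (fun t => Gt (t 0)) := by
    have hXn : IsSemialgebraicFunOn ℚ Sm (fun z => -(z 0)) :=
      (isSemialgebraicFunOn_aeval hSm (-MvPolynomial.X 0)).congr fun z _ => by simp
    have hmap : IsSemialgebraicMapOn ℚ Sm (fun z : Fin 1 → ℝ => fun _ : Fin 1 => -(z 0)) :=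
      IsSemialgebraicMapOn.of_forall hSm fun _ => hXn
    have hmaps : MapsTo (fun z : Fin 1 → ℝ => fun _ : Fin 1 => -(z 0)) Sm Sp := by
      intro z hz
      have hz' : z 0 ∈ Ioo (-(ρ₁ : ℝ)) 0 := hz
      exact ⟨by linarith [hz'.2], by linarith [hz'.1]⟩
    have hcomp := IsSemialgebraicFunOn.comp_isSemialgebraicMapOn_holds hGsa hmap hmaps
    exact hcomp.neg.congr fun z hz => by
      simp only [Pi.neg_apply, Function.comp]
      exact (hGtm z hz).symm
  have h3 : IsSemialgebraicFunOn ℚ S0 (fun t => Gt (t 0)) := by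
    refine (isSemialgebraicFunOn_const_of_isAlgebraic hS0 isAlgebraic_zero).congr fun z hz => ?_
    have hz0 : z 0 = 0 := hz
    show (0 : ℝ) = Gt (z 0)
    rw [hz0, hGtJ 0 hρ₀pos, hJ]
    simp
  have hUeq : U = (Sm ∪ S0) ∪ Sp := by
    refine Set.ext fun t => ⟨fun ht => ?_, fun ht => ?_⟩
    · have ht' : t 0 ∈ Ioo (-(ρ₁ : ℝ)) w₁ := ht
      rcases lt_trichotomy (t 0) 0 with h0 | h0 | h0
      · exact Or.inl (Or.inl (show t 0 ∈ Ioo (-(ρ₁ : ℝ)) 0 from ⟨ht'.1, h0⟩))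
      · exact Or.inl (Or.inr (show t 0 = 0 from h0))
      · exact Or.inr (show t 0 ∈ Ioo (0 : ℝ) w₁ from ⟨h0, ht'.2⟩)
    · show t 0 ∈ Ioo (-(ρ₁ : ℝ)) w₁
      rcases ht with (ht | ht) | ht
      · have ht' : t 0 ∈ Ioo (-(ρ₁ : ℝ)) 0 := ht
        exact ⟨ht'.1, by linarith [ht'.2]⟩
      · rw [show t 0 = 0 from ht]; exact ⟨by linarith, by linarith⟩
      · have ht' : t 0 ∈ Ioo (0 : ℝ) w₁ := ht
        exact ⟨by linarith [ht'.1], ht'.2⟩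
  have hGtsa : IsSemialgebraicFunOn ℚ U (fun t => Gt (t 0)) := by
    rw [hUeq]
    exact (h2.union h3 (fun _ _ => rfl) (fun _ _ => rfl)).union h1 (fun _ _ => rfl) (fun _ _ => rfl)
  -- ### the cube representation `[∫_{[0,1]} Gt]`
  have hcube : Set.pi Set.univ (fun _ : Fin 1 => Set.Icc (0 : ℝ) 1) =
      {t : Fin 1 → ℝ | t 0 ∈ Icc (0 : ℝ) 1} := by
    ext t
    simp only [Set.mem_univ_pi, Set.mem_setOf_eq, Fin.forall_fin_one]
  have hcubeU : Set.pi Set.univ (fun _ : Fin 1 => Set.Icc (0 : ℝ) 1) ⊆ U := by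
    rw [hcube]
    intro t ht
    show t 0 ∈ Ioo (-(ρ₁ : ℝ)) w₁
    exact ⟨by linarith [ht.1], by linarith [ht.2]⟩
  have hUopen : IsOpen U := isOpen_Ioo.preimage (continuous_apply 0)
  have hGtU : AnalyticOnNhd ℝ (fun t : Fin 1 → ℝ => Gt (t 0)) U := by
    intro t ht
    have ht' : t 0 ∈ Ioo (-(ρ₁ : ℝ)) w₁ := ht
    have ha : AnalyticAt ℝ Gt (t 0) := hGtan (t 0) ⟨by linarith [ht'.1], ht'.2⟩
    have hproj : AnalyticAt ℝ (fun t : Fin 1 → ℝ => t 0) t :=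
      (ContinuousLinearMap.proj (R := ℝ) (φ := fun _ : Fin 1 => ℝ) 0).analyticAt t
    exact AnalyticAt.comp (g := Gt) (f := fun t : Fin 1 → ℝ => t 0) ha hproj
  have hcube_sa : IsSemialgebraic ℚ (Set.pi Set.univ (fun _ : Fin 1 => Set.Icc (0 : ℝ) 1)) := by
    rw [hcube]
    have h' := (hU.union (isSemialgebraic_setOf_apply_eq_of_isAlgebraic isAlgebraic_zero (0 : Fin 1))).union
      (isSemialgebraic_setOf_apply_eq_of_isAlgebraic isAlgebraic_one (0 : Fin 1))
    convert h' using 1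
    ext t
    simp only [Set.mem_setOf_eq, Set.mem_union, Set.mem_Icc, Set.mem_Ioo]
    constructor
    · rintro ⟨h0, h1'⟩
      rcases h0.lt_or_eq with h0 | h0
      · rcases h1'.lt_or_eq with h1' | h1'
        · exact Or.inl (Or.inl ⟨h0, h1'⟩)
        · exact Or.inr h1'
      · exact Or.inl (Or.inr h0.symm)
    · rintro ((⟨h0, h1'⟩ | h0) | h1')
      · exact ⟨h0.le, h1'.le⟩
      · rw [h0]; exact ⟨le_rfl, zero_le_one⟩
      · rw [h1']; exact ⟨zero_le_one, le_rfl⟩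
  have hcube_cpt : IsCompact (Set.pi Set.univ (fun _ : Fin 1 => Set.Icc (0 : ℝ) 1)) :=
    isCompact_univ_pi fun _ => isCompact_Icc
  let s : IntegralRep 1 :=
    { domain := Set.pi Set.univ (fun _ : Fin 1 => Set.Icc (0 : ℝ) 1)
      integrand := fun t => Gt (t 0)
      isSemialgebraic_domain := hcube_sa
      isSemialgebraicFunOn_integrand := hGtsa.mono hcubeU hcube_sa
      integrableOn := (hGtU.continuousOn.mono hcubeU).integrableOn_compact hcube_cpt }
  have eRs : of R - of s ∈ relations := by
    refine of_sub_of_mem_relations_of_null R s ?_ ?_ fun z hz => ?_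
    · rw [hRdom]
      refine measure_mono_null (fun z hz => ?_) measure_empty
      refine (hz.2 ?_).elim
      show z ∈ Set.pi Set.univ (fun _ : Fin 1 => Set.Icc (0 : ℝ) 1)
      rw [hcube]
      exact ⟨hz.1.1.le, hz.1.2.le⟩
    · refine measure_mono_null (fun z hz => ?_)
        (measure_union_null (volume_setOf_apply_eq 0) (volume_setOf_apply_eq 1))
      obtain ⟨hz1, hz2⟩ := hz
      have hz1' : z ∈ Set.pi Set.univ (fun _ : Fin 1 => Set.Icc (0 : ℝ) 1) := hz1
      rw [hcube] at hz1'
      rw [hRdom] at hz2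
      have hz2' : ¬ (z 0 ∈ Ioo (0 : ℝ) 1) := hz2
      rcases hz1'.1.lt_or_eq with h0 | h0
      · rcases hz1'.2.lt_or_eq with h1' | h1'
        · exact absurd ⟨h0, h1'⟩ hz2'
        · exact Or.inr h1'
      · exact Or.inl h0.symm
    · have hz1 : z ∈ R.domain := hz.1
      rw [hRG z hz1]
      rw [hRdom] at hz1
      show G (z 0) = Gt (z 0)
      exact (hGtG (z 0) hz1.1).symm
  have hs : of s ∈ N := hgen s (fun t => Gt (t 0)) U hUopen hcubeU hGtsa hGtU rfl (fun _ _ => rfl)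
  -- ### assembly
  have e1 : of R - of (cut r lo hi) ∈ relations := changeOfVariablesRel_subset_relations hRcov
  have : of (cut r lo hi) = -(of R - of (cut r lo hi)) + (of R - of s) + of s := by abel
  rw [this]
  exact N.add_mem (N.add_mem (N.neg_mem (hrel e1)) (hrel eRs)) hs

end Summit.KontsevichZagierPeriods.LiftingCriteria.CubeNashNormalFormHalfCell
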